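import Summits.HodgeConjecture.HodgeConjecture.Theorems.FermatCyclesAokiMatchGapClass
import HarnessLib

/-!
# Fermat cycles — Aoki (2002) vs the `F*(3p)` ℤ/2 gap generator, Part VII-A: integer-lattice tools for `ker θ ⊆ S + D` —
# `p`-adic descent from a left inverse mod `p`, the antisymmetrised Hodge row on a half system, and «integer identity of
# count vectors ⇒ multiset identity in the semigroup `S + D`»

HONEST FRAMING: explicit algebraic cycles for specific Hodge classes on Fermat/Delsarte varieties;
residual open instances listed; no claim on general Hodge.

Cell `pub-hfermat`, seat `aoki-match` (gen-56).  Generic lemmas (no level data) used by Part VII-B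
(`FermatCyclesAokiMatchGapExact.lean`, the certificate principle for `B/(S+D) = {[0], [g]}`) and its level files.  HELPER of the
cell's statement item, no closure claim; linear algebra over `ℤ` only, nothing geometric.
* `hval m t x = 2⟨t x⟩_m − m` — the Hodge row of a unit `t` [Shioda1979PJA §1 (2)], as in Part IV's `hodge_row_int`.
* `eq_zero_of_leftInverse_mod` — if integer rows `E_a` satisfy `Σ_t E_a(t) h_t(b) ≡ δ_ab (mod p)` on the non-pivot columns
  `a, b ∈ T ∖ P` (`p > 1`), an integer vector on `T` vanishing on `P` and killed by the rows `h_t` vanishes (descent on `Σ|x|`).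
* `rowT T t f = Σ_{a∈T} (f a − f(−a)) h_t(a)`, its linearity (`rowT_sub_mul`, `rowT_sub_sum`); `IsHalfSystem T`; for a multiset
  `s` without `0`, `Σ_{x∈s} h_t(x) = rowT T t (count s)` (`sum_hval_eq_rowT_count`); a symmetric vector vanishing at `0` is
  `Σ_{a∈T} w(a)·#{a,−a}` (`symm_eq_sum_pairs`).
* `posPart` / `negPart` of an integer-weighted list of multisets and `multiset_eq_of_count_eq`: `#s = #t + Σ n_γ #γ` gives
  `s + Σ(−n_γ)⁺•γ = t + Σ n_γ⁺•γ`; both parts lie in `AddSubmonoid.closure (SDGen m q)` when the `γ` are generators (Part V's `SDGen`).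

References: [Shioda1979PJA] T. Shioda, Proc. Japan Acad. 55A (1979) 111–114, §1 eqs. (2), (3); [Aoki2002CMFermatType] N. Aoki,
Comment. Math. Univ. St. Pauli 51 (2002) 99–130, (9)–(10) p. 106–107 (the generators of `S + D`).
-/

set_option linter.dupNamespace false -- D-0017: summit = sub-problem (`Summit.HodgeConjecture.HodgeConjecture.…`)

open Literature.AlgebraicGeometry.HodgeTheory Literature.AlgebraicGeometry.HodgeTheory.FermatCharacter

namespace Summit.HodgeConjecture.HodgeConjecture.FermatCycles.AokiMatch

/-! ## Part VII-A.1 — list algebra used by the certificate principle -/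

/-- `Σ_{a ∈ L} (if a = x then f a else 0) = f x` or `0` for a duplicate-free list. [folklore] -/
theorem list_sum_map_ite_eq {α : Type*} [DecidableEq α] (L : List α) (hL : L.Nodup) (x : α) (f : α → ℤ) :
    (L.map fun a => if a = x then f a else 0).sum = if x ∈ L then f x else 0 := by
  induction L with
  | nil => simp
  | cons b L ih =>
    rw [List.nodup_cons] at hL
    rw [List.map_cons, List.sum_cons, ih hL.2]
    by_cases hb : b = x
    · subst hb
      simp [hL.1]
    · have : (x ∈ b :: L) ↔ x ∈ L := by simp [Ne.symm hb]
      simp [hb, this]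

/-- `Σ_{a ∈ L} (f a − g a) = Σ f − Σ g`. [folklore] -/
theorem list_sum_map_sub {α : Type*} (L : List α) (f g : α → ℤ) :
    (L.map fun a => f a - g a).sum = (L.map f).sum - (L.map g).sum := by
  induction L with
  | nil => simp
  | cons b L ih => simp only [List.map_cons, List.sum_cons, ih]; ring

/-- `Σ_{e ∈ L} Σ_{y ∈ F e} = Σ` over the flattened list. [folklore] -/
theorem list_sum_flatMap {α β : Type*} (L : List α) (F : α → List β) (v : β → ℤ) :
    ((L.flatMap F).map v).sum = (L.map fun e => ((F e).map v).sum).sum := by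
  induction L with
  | nil => simp
  | cons b L ih => simp [List.flatMap_cons, ih]

/-- Swapping two finite list sums. [folklore] -/
theorem list_sum_sum_swap {α β : Type*} (L : List α) (K : List β) (F : α → β → ℤ) :
    (K.map fun b => (L.map fun a => F a b).sum).sum = (L.map fun a => (K.map fun b => F a b).sum).sum := by
  induction L with
  | nil => simp
  | cons a L ih =>
    simp only [List.map_cons, List.sum_cons]
    rw [List.sum_map_add, ih]

/-! ## Part VII-A.2 — `p`-adic descent: a left inverse mod `p` on the non-pivot columns makes the restricted Hodge matrix injective -/

/-- `h_t(x) = 2⟨t·x⟩_m − m`, the Hodge row of the unit `t` at the residue `x`, as an integer. [cite: Shioda1979PJA, §1 eq. (2)] -/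
def hval (m t : ℕ) (x : ZMod m) : ℤ := 2 * ((t * x.val % m : ℕ) : ℤ) - (m : ℤ)

/-- **Descent lemma.**  Let `T ⊇ P` be lists of residues (`T` duplicate-free), `R` a list of rows, and suppose that for every non-pivot
`a ∈ T ∖ P` an integer row `E_a` (aligned with `R`) is given with `Σ_{t} E_a(t)·h_t(b) ≡ δ_{ab} (mod p)` for all non-pivots `b` (`p > 1`).
Then an integer vector `x` on `T` vanishing on `P` with `Σ_{b∈T} h_t(b)·x(b) = 0` for all `t ∈ R` vanishes on `T`: reading the
relations mod `p` gives `p ∣ x`, and `x/p` satisfies the same relations (infinite descent on `Σ|x|`). [folklore] -/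
theorem eq_zero_of_leftInverse_mod {m : ℕ} (T P : List (ZMod m)) (hT : T.Nodup) (R : List ℕ) (p : ℕ) (hp : 1 < p)
    (EL : List (ZMod m × List ℤ))
    (hcov : ∀ a ∈ T, a ∉ P → ∃ e ∈ EL, e.1 = a)
    (hE : ∀ e ∈ EL, ∀ b ∈ T, b ∉ P →
      ((R.zip e.2).map fun te => te.2 * hval m te.1 b).sum % (p : ℤ) = if e.1 = b then 1 else 0) :
    ∀ x : ZMod m → ℤ, (∀ a ∈ P, x a = 0) → (∀ t ∈ R, (T.map fun b => hval m t b * x b).sum = 0) → ∀ a ∈ T, x a = 0 := by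
  have hp0 : (p : ℤ) ≠ 0 := by exact_mod_cast (by omega : p ≠ 0)
  -- Step 1: the relations force `p ∣ x a` for every `a ∈ T`.
  have hdiv : ∀ x : ZMod m → ℤ, (∀ a ∈ P, x a = 0) → (∀ t ∈ R, (T.map fun b => hval m t b * x b).sum = 0) →
      ∀ a ∈ T, (p : ℤ) ∣ x a := by
    intro x hP hR a ha
    by_cases haP : a ∈ P
    · rw [hP a haP]; exact dvd_zero _
    obtain ⟨e, he, rfl⟩ := hcov a ha haP
    let S : ZMod m → ℤ := fun b => ((R.zip e.2).map fun te => te.2 * hval m te.1 b).sum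
    -- Σ_b S(b)·x(b) = Σ_{(t,E)} E · (Σ_b h_t(b) x(b)) = 0
    have h1 : (T.map fun b => S b * x b).sum = 0 := by
      have h3 : (T.map fun b => S b * x b).sum =
          ((R.zip e.2).map fun te => te.2 * (T.map fun b => hval m te.1 b * x b).sum).sum := by
        have : (T.map fun b => S b * x b) = T.map fun b => ((R.zip e.2).map fun te => te.2 * (hval m te.1 b * x b)).sum := by
          refine List.map_congr_left fun b _ => ?_
          show ((R.zip e.2).map fun te => te.2 * hval m te.1 b).sum * x b = _
          rw [← List.sum_map_mul_right]
          refine congrArg _ (List.map_congr_left fun te _ => ?_)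
          ring
        rw [this, list_sum_sum_swap]
        refine congrArg _ (List.map_congr_left fun te _ => ?_)
        rw [List.sum_map_mul_left]
      rw [h3]
      refine List.sum_eq_zero (fun v hv => ?_)
      obtain ⟨te, hte, rfl⟩ := List.mem_map.1 hv
      rw [hR te.1 (List.of_mem_zip hte).1, mul_zero]
    -- each coefficient is `δ_{ab} + p·k_b` on non-pivots, and `x b = 0` on pivots
    have h4 : ∀ b ∈ T, S b * x b = (if b = e.1 then x b else 0) + (p : ℤ) * (S b / (p : ℤ) * x b) := by
      intro b hb
      by_cases hbP : b ∈ P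
      · rw [hP b hbP]; simp
      · have hmod := hE e he b hb hbP
        have hdecomp : S b % (p : ℤ) + (p : ℤ) * (S b / (p : ℤ)) = S b := Int.emod_add_mul_ediv _ _
        rw [hmod] at hdecomp
        by_cases hbe : b = e.1
        · rw [if_pos hbe]; rw [if_pos hbe.symm] at hdecomp; linear_combination (-(x b)) * hdecomp
        · rw [if_neg hbe]; rw [if_neg (Ne.symm hbe)] at hdecomp; linear_combination (-(x b)) * hdecomp
    rw [show (T.map fun b => S b * x b) =
        T.map fun b => (if b = e.1 then x b else 0) + (p : ℤ) * (S b / (p : ℤ) * x b) from List.map_congr_left h4,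
      List.sum_map_add, List.sum_map_mul_left, list_sum_map_ite_eq T hT e.1 x, if_pos ha] at h1
    exact ⟨-((T.map fun b => S b / (p : ℤ) * x b).sum), by linarith⟩
  -- Step 2: descent on `Σ_{a∈T} |x a|`.
  suffices H : ∀ n : ℕ, ∀ x : ZMod m → ℤ, (T.map fun a => (x a).natAbs).sum = n → (∀ a ∈ P, x a = 0) →
      (∀ t ∈ R, (T.map fun b => hval m t b * x b).sum = 0) → ∀ a ∈ T, x a = 0 by
    intro x hP hR; exact H _ x rfl hP hR
  intro n
  induction n using Nat.strong_induction_on with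
  | _ n ih =>
    intro x hn hP hR
    have hd := hdiv x hP hR
    let y : ZMod m → ℤ := fun a => x a / p
    have hxy : ∀ a ∈ T, x a = p * y a := fun a ha => (Int.mul_ediv_cancel' (hd a ha)).symm
    have hyP : ∀ a ∈ P, y a = 0 := by
      intro a ha; show x a / p = 0; rw [hP a ha]; simp
    have hyR : ∀ t ∈ R, (T.map fun b => hval m t b * y b).sum = 0 := by
      intro t ht
      have h := hR t ht
      rw [show (T.map fun b => hval m t b * x b) = T.map fun b => (p : ℤ) * (hval m t b * y b) from
        List.map_congr_left fun b hb => by rw [hxy b hb]; ring, List.sum_map_mul_left] at h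
      rcases mul_eq_zero.1 h with h | h
      · exact absurd h hp0
      · exact h
    have hnorm : (T.map fun a => (x a).natAbs).sum = p * (T.map fun a => (y a).natAbs).sum := by
      rw [show (T.map fun a => (x a).natAbs) = T.map fun a => p * (y a).natAbs from
        List.map_congr_left fun a ha => by rw [hxy a ha, Int.natAbs_mul, Int.natAbs_natCast], List.sum_map_mul_left]
    rcases Nat.eq_zero_or_pos n with h0 | hpos
    · -- every |x a| vanishes
      intro a ha
      have hle : (x a).natAbs ≤ (T.map fun a => (x a).natAbs).sum := List.le_sum_of_mem (List.mem_map.2 ⟨a, ha, rfl⟩)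
      rw [hn, h0] at hle
      exact Int.natAbs_eq_zero.1 (Nat.le_zero.1 hle)
    · have hny : 0 < (T.map fun a => (y a).natAbs).sum := by
        rcases Nat.eq_zero_or_pos (T.map fun a => (y a).natAbs).sum with h | h
        · rw [h, mul_zero] at hnorm; omega
        · exact h
      have hlt : (T.map fun a => (y a).natAbs).sum < n := by
        rw [← hn, hnorm]; nlinarith
      have hy := ih _ hlt y rfl hyP hyR
      intro a ha
      rw [hxy a ha, hy a ha, mul_zero]

/-! ## Part VII-A.3 — the row functional on the half system, symmetric vectors, multiset identities -/

/-- The antisymmetrised Hodge row on the half system `T`: `Row_t(f) = Σ_{a∈T} (f a − f(−a))·h_t(a)`. [folklore] -/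
def rowT {m : ℕ} (T : List (ZMod m)) (t : ℕ) (f : ZMod m → ℤ) : ℤ := (T.map fun a => (f a - f (-a)) * hval m t a).sum

/-- `Row_t` is compatible with subtracting a multiple: `Row_t(f − κ·F) = Row_t(f) − κ·Row_t(F)`. [folklore] -/
theorem rowT_sub_mul {m : ℕ} (T : List (ZMod m)) (t : ℕ) (f F : ZMod m → ℤ) (κ : ℤ) :
    rowT T t (fun x => f x - κ * F x) = rowT T t f - κ * rowT T t F := by
  unfold rowT
  rw [← List.sum_map_mul_left, ← list_sum_map_sub]
  refine congrArg _ (List.map_congr_left fun a _ => ?_)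
  ring

/-- `Row_t(f − Σ_{e∈L} κ_e·F_e) = Row_t(f) − Σ_e κ_e·Row_t(F_e)`. [folklore] -/
theorem rowT_sub_sum {m : ℕ} {ρ : Type*} (T : List (ZMod m)) (t : ℕ) (L : List ρ) (κ : ρ → ℤ) (F : ρ → ZMod m → ℤ)
    (f : ZMod m → ℤ) :
    rowT T t (fun x => f x - (L.map fun e => κ e * F e x).sum) = rowT T t f - (L.map fun e => κ e * rowT T t (F e)).sum := by
  induction L generalizing f with
  | nil => simp [rowT]
  | cons e L ih =>
    simp only [List.map_cons, List.sum_cons]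
    have : (fun x => f x - (κ e * F e x + (L.map fun e => κ e * F e x).sum)) =
        fun x => (f x - κ e * F e x) - (L.map fun e => κ e * F e x).sum := by
      funext x; ring
    rw [this, ih, rowT_sub_mul]
    ring

/-- **Half system.** `T` is duplicate-free, `0 ∉ ±T`, `T ∩ (−T) = ∅`, and every non-zero residue lies in `T` or in `−T`. (Decidable.) [folklore] -/
def IsHalfSystem {m : ℕ} (T : List (ZMod m)) : Prop :=
  T.Nodup ∧ (∀ a ∈ T, a ≠ 0 ∧ -a ∉ T) ∧ ∀ x : ZMod m, x ≠ 0 → x ∈ T ∨ -x ∈ T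

/-- `IsHalfSystem` is decidable (finite conjunction over `T` and `ℤ/m`). [folklore] -/
instance {m : ℕ} [NeZero m] (T : List (ZMod m)) : Decidable (IsHalfSystem T) := by
  unfold IsHalfSystem; infer_instance

/-- For a multiset without `0`, `Σ_{x∈s} h_t(x) = Row_t(count s)` when `h_t` is odd on `±T`. [folklore] -/
theorem sum_hval_eq_rowT_count {m : ℕ} {T : List (ZMod m)} (hT : IsHalfSystem T) {t : ℕ}
    (hodd : ∀ a ∈ T, hval m t (-a) = -hval m t a) (s : Multiset (ZMod m)) (hs : ∀ x ∈ s, x ≠ 0) :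
    (s.map (hval m t)).sum = rowT T t (fun x => (s.count x : ℤ)) := by
  induction s using Multiset.induction_on with
  | empty => simp [rowT]
  | cons x₀ s ih =>
    have hx₀ : x₀ ≠ 0 := hs x₀ (Multiset.mem_cons_self _ _)
    have hs' : ∀ x ∈ s, x ≠ 0 := fun x hx => hs x (Multiset.mem_cons_of_mem hx)
    rw [Multiset.map_cons, Multiset.sum_cons, ih hs']
    -- count (x₀ ::ₘ s) = count s + δ_{x₀}
    have hc : (fun x => ((x₀ ::ₘ s).count x : ℤ)) = fun x => (s.count x : ℤ) - (-1) * (if x = x₀ then 1 else 0) := by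
      funext x
      rw [Multiset.count_cons]
      split_ifs <;> push_cast <;> ring
    rw [hc, rowT_sub_mul]
    -- Row_t(δ_{x₀}) = h_t(x₀)
    suffices h : rowT T t (fun x => if x = x₀ then (1 : ℤ) else 0) = hval m t x₀ by rw [h]; ring
    unfold rowT
    have e1 : ∀ a : ZMod m, ((if a = x₀ then (1 : ℤ) else 0) - (if -a = x₀ then 1 else 0)) * hval m t a =
        (if a = x₀ then hval m t a else 0) - (if a = -x₀ then hval m t a else 0) := by
      intro a
      simp only [neg_eq_iff_eq_neg]
      split_ifs <;> ring
    rw [show (T.map fun a => ((if a = x₀ then (1 : ℤ) else 0) - (if -a = x₀ then 1 else 0)) * hval m t a) =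
        T.map fun a => (if a = x₀ then hval m t a else 0) - (if a = -x₀ then hval m t a else 0) from
      List.map_congr_left fun a _ => e1 a,
      list_sum_map_sub, list_sum_map_ite_eq T hT.1 x₀, list_sum_map_ite_eq T hT.1 (-x₀)]
    rcases hT.2.2 x₀ hx₀ with h | h
    · rw [if_pos h, if_neg (hT.2.1 x₀ h).2, sub_zero]
    · have hn : x₀ ∉ T := by
        intro h'; exact (hT.2.1 x₀ h').2 h
      have h' := hodd (-x₀) h
      rw [neg_neg] at h'
      rw [if_neg hn, if_pos h, h']; ring

/-- A symmetric vector vanishing at `0` is the combination `Σ_{a∈T} w(a)·#{a,−a}` of pair count vectors. [folklore] -/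
theorem symm_eq_sum_pairs {m : ℕ} {T : List (ZMod m)} (hT : IsHalfSystem T) (w : ZMod m → ℤ)
    (hsymm : ∀ a ∈ T, w a = w (-a)) (h0 : w 0 = 0) (x : ZMod m) :
    w x = (T.map fun a => w a * (Multiset.count x ({a, -a} : Multiset (ZMod m)) : ℤ)).sum := by
  have hcount : ∀ a : ZMod m, (Multiset.count x ({a, -a} : Multiset (ZMod m)) : ℤ) =
      (if x = a then 1 else 0) + (if x = -a then 1 else 0) := by
    intro a
    rw [Multiset.insert_eq_cons, Multiset.count_cons, Multiset.count_singleton]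
    split_ifs <;> simp
  simp_rw [hcount, mul_add]
  rw [List.sum_map_add]
  rw [show (T.map fun a => w a * if x = a then (1 : ℤ) else 0) = T.map fun a => if a = x then w a else 0 from
      List.map_congr_left fun a _ => by
        by_cases h : a = x
        · rw [if_pos h, if_pos h.symm, mul_one]
        · rw [if_neg h, if_neg (fun h' => h h'.symm), mul_zero],
    show (T.map fun a => w a * if x = -a then (1 : ℤ) else 0) = T.map fun a => if a = -x then w a else 0 from
      List.map_congr_left fun a _ => by
        by_cases h : a = -x
        · rw [if_pos h, if_pos (by rw [h, neg_neg]), mul_one]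
        · rw [if_neg h, if_neg (fun h' => h (neg_eq_iff_eq_neg.mp h'.symm)), mul_zero],
    list_sum_map_ite_eq T hT.1 x w, list_sum_map_ite_eq T hT.1 (-x) w]
  by_cases hx : x = 0
  · subst hx
    have h1 : (0 : ZMod m) ∉ T := fun h => (hT.2.1 0 h).1 rfl
    rw [if_neg h1, neg_zero, if_neg h1, h0]; simp
  rcases hT.2.2 x hx with h | h
  · rw [if_pos h, if_neg (hT.2.1 x h).2, add_zero]
  · have hn : x ∉ T := fun h' => (hT.2.1 x h').2 h
    rw [if_neg hn, if_pos h, zero_add, hsymm (-x) h, neg_neg]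

/-- Positive part of an integer-weighted list of multisets: `Σ n⁺ • γ`. [folklore] -/
def posPart {α : Type*} [DecidableEq α] (Φ : List (ℤ × Multiset α)) : Multiset α :=
  (Φ.map fun nγ : ℤ × Multiset α => nγ.1.toNat • nγ.2).sum
/-- Negative part of an integer-weighted list of multisets: `Σ (−n)⁺ • γ`. [folklore] -/
def negPart {α : Type*} [DecidableEq α] (Φ : List (ℤ × Multiset α)) : Multiset α :=
  (Φ.map fun nγ : ℤ × Multiset α => (-nγ.1).toNat • nγ.2).sum

/-- Count vector of the positive part. [folklore] -/
theorem count_posPart {α : Type*} [DecidableEq α] (Φ : List (ℤ × Multiset α)) (x : α) :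
    (((posPart Φ).count x : ℕ) : ℤ) = (Φ.map fun nγ : ℤ × Multiset α => ((nγ.1.toNat : ℕ) : ℤ) * (nγ.2.count x : ℤ)).sum := by
  unfold posPart
  induction Φ with
  | nil => simp
  | cons nγ Φ ih =>
    rw [List.map_cons, List.sum_cons, Multiset.count_add, Nat.cast_add, ih, List.map_cons, List.sum_cons,
      Multiset.count_nsmul, Nat.cast_mul]

/-- Count vector of the negative part. [folklore] -/
theorem count_negPart {α : Type*} [DecidableEq α] (Φ : List (ℤ × Multiset α)) (x : α) :
    (((negPart Φ).count x : ℕ) : ℤ) = (Φ.map fun nγ : ℤ × Multiset α => (((-nγ.1).toNat : ℕ) : ℤ) * (nγ.2.count x : ℤ)).sum := by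
  unfold negPart
  induction Φ with
  | nil => simp
  | cons nγ Φ ih =>
    rw [List.map_cons, List.sum_cons, Multiset.count_add, Nat.cast_add, ih, List.map_cons, List.sum_cons,
      Multiset.count_nsmul, Nat.cast_mul]

/-- **From an integer identity of count vectors to a multiset identity**: if `#s = #t + Σ n_γ·#γ` then
`s + Σ (−n_γ)⁺•γ = t + Σ n_γ⁺•γ`. [folklore] -/
theorem multiset_eq_of_count_eq {α : Type*} [DecidableEq α] (s t : Multiset α) (Φ : List (ℤ × Multiset α))
    (h : ∀ x, (s.count x : ℤ) = (t.count x : ℤ) + (Φ.map fun nγ : ℤ × Multiset α => nγ.1 * (nγ.2.count x : ℤ)).sum) :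
    s + negPart Φ = t + posPart Φ := by
  ext x
  have e := h x
  have key : (Φ.map fun nγ : ℤ × Multiset α => ((nγ.1.toNat : ℕ) : ℤ) * (nγ.2.count x : ℤ)).sum -
      (Φ.map fun nγ : ℤ × Multiset α => (((-nγ.1).toNat : ℕ) : ℤ) * (nγ.2.count x : ℤ)).sum =
      (Φ.map fun nγ : ℤ × Multiset α => nγ.1 * (nγ.2.count x : ℤ)).sum := by
    rw [← list_sum_map_sub]
    refine congrArg _ (List.map_congr_left fun nγ _ => ?_)
    rw [← sub_mul, Int.toNat_sub_toNat_neg]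
  have : ((s + negPart Φ).count x : ℤ) = ((t + posPart Φ).count x : ℤ) := by
    rw [Multiset.count_add, Multiset.count_add, Nat.cast_add, Nat.cast_add, count_posPart, count_negPart]
    linarith
  exact_mod_cast this

/-- Every member of an `SDGen`-weighted list gives closure elements: `posPart`, `negPart ∈ S + D`. [folklore] -/
theorem posPart_negPart_mem_closure {m q : ℕ} (Φ : List (ℤ × Multiset (ZMod m))) (hΦ : ∀ nγ ∈ Φ, nγ.2 ∈ SDGen m q) :
    posPart Φ ∈ AddSubmonoid.closure (SDGen m q) ∧ negPart Φ ∈ AddSubmonoid.closure (SDGen m q) := by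
  constructor
  · unfold posPart
    refine list_sum_mem (fun v hv => ?_)
    obtain ⟨nγ, hnγ, rfl⟩ := List.mem_map.1 hv
    exact nsmul_mem (AddSubmonoid.subset_closure (hΦ nγ hnγ)) _
  · unfold negPart
    refine list_sum_mem (fun v hv => ?_)
    obtain ⟨nγ, hnγ, rfl⟩ := List.mem_map.1 hv
    exact nsmul_mem (AddSubmonoid.subset_closure (hΦ nγ hnγ)) _

end Summit.HodgeConjecture.HodgeConjecture.FermatCycles.AokiMatch
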